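import Summits.BirchSwinnertonDyer.Rank2Observatory.ZywinaFamilyAdmissible
import HarnessLib

/-!
# The canonical `p`-adic heights of Zywina's generators in closed form, and Schneider's conjecture
# for `E_{m,n}` at every prime `p ≥ 5` dividing `n` with `‖n‖_p² < ‖½ log_p m‖_p`
# (cell bsd-rank2, THEOREM R* of seat p2 gen 3 — kernel form by seat bsd-rank2-lit gen 4)

Cell-side file (the cell's OWN result, not a published statement — hence not under `Literature/`).
`E_{m,n} : y² = x³ - 5q x² + 4qr x` (`q = m + 16n²`, `r = m + 25n²`) is Zywina's rank-`2` family
(`Literature.NumberTheory.EllipticCurves.Zywina2025RankTwo`: `zywinaCurve`, `ZywinaAdmissible`,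
`mordellWeilRank_zywinaCurve`), with Zywina's points `P₁ = (q, 6nq)`, `P₂ = (36n², 12n(m - 2n²))`.

**THEOREM R\* (HOME/p2/PADIC-R2-G3.md §1–§2, refereed PASS in REFEREE-R2.md report #8).** For
`(m, n)` admissible, `p ≥ 5` prime with `p ∣ n`, and `D` THE canonical `p`-adic height datum of
`E_{m,n}` (`PAdicHeightData.IsCanonical`, Stein–Wuthrich normalisation), with `Λ = ½ log_p m`:

  (i)  `‖⟨P₁,P₁⟩ - Λ‖_p ≤ ‖n‖_p²`, `‖⟨P₂,P₂⟩ - 2Λ‖_p ≤ ‖n‖_p²`, `‖⟨P₁+P₂,P₁+P₂⟩ - Λ‖_p ≤ ‖n‖_p²`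
       (`closedFormHeights`; `‖n‖_p² = p^{-2ν}`, the STRONG form of the memo);
  (ii) if `‖n‖_p² < ‖Λ‖_p` then `Reg_D(P₁, P₂) ≠ 0` (`padicRegulatorOf_ne_zero`);
  (iii) hence `SchneiderConjecture D` (`schneiderConjecture`), by the index lemma on the rank-`2`
       curve `E_{m,n}`.

Proof = memo §2, formalised over the Literature ingredients landed for it:
* LEMMA H (`CanonicalPAdicHeightNumeratorProofs.lean`, p404730):
  `‖ĥ_p(Q) - log_p(num x(Q))‖_p ≤ ‖x(Q)‖_p⁻¹` for `a₁ = a₃ = 0`;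
* admissibility toolkit (`CanonicalPAdicHeightAdmissibilityCriteria.lean`, p405432): coordinate
  tests for `E₀`, good primes via the resultant, torsion-freeness of `E₁(ℚ_p)` for integral
  equations, `isAdmissible_of_one_lt_norm`, the duplication `x`-coordinate;
* index formula (`PAdicRegulatorFiniteIndexProofs.lean`, p404469):
  `schneiderConjecture_of_padicRegulatorOf_pair_ne_zero`.
This is file 4 of 4. Files 1–3 (same namespace): `ZywinaFamilyPoints` (§Setup: integrality,
`a₁ = a₃ = a₆ = 0`, arithmetic of admissible `(m,n)`: `2, 3 ∣ n`, `m, q, r ∤ n`; §Points/§Doubles: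
`P₁ + P₂ = (4q, 12nq)`, `x(2P₁) = (m+28n²)²/(4n)²`, `x(2P₂) = (m²+41mn²+76n⁴)²/(6n(m-2n²))²`,
`x(2(P₁+P₂)) = (m+13n²)²/(2n)²; §Generic), `ZywinaFamilyReduction` (§Coprime; §Reduction: `2P₁`,
`2P₂` reduce non-singularly at EVERY prime — denominator primes by `‖x‖_ℓ > 1`, the bad primes
`m, q, r` by the unit test `‖y‖_ℓ = 1` computed modulo `ℓ`, `(y d³)² = N ≡ c·n^k` with
`c ∈ {2¹²3⁴7², 2¹²3⁶, 3¹⁰, 2¹²19², 2¹²3²⁴, 2¹⁰3²⁴7²}`, all other primes by `ℓ ∤ Δ = 2⁸3²mq³r²`),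
`ZywinaFamilyAdmissible` (§Admissible at `p ∣ n`, `p ≥ 5`: `‖x(2P_i)‖_p⁻¹ = ‖n‖_p²`;
`2(P₁+P₂) = 2P₁ + 2P₂` through the subgroup `E₀`). Here: §Heights (`⟨P,P⟩ = ¼ĥ_p(2P)`,
`log_p(num) = 2 log_p α`, `α = m(1 + O(n²))` resp. `m²(1 + O(n²))`) and §ClosedForm ((i)–(iii);
the `2 × 2` ultrametric perturbation `padicRegulatorOf_pair_ne_zero_of_near` re-proves p2-g3's
`PadicRank2SketchG3` §A in tree vocabulary).

B1 honesty: `p`-adic height ALGEBRA on a rank-`2` family; no clause mentions the analytic rank; this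
is node N3 of `HOME/S0-DOORS.md` (the regulator door, INSIDE the Schneider barrier) made kernel at
member level — the class level (`C(p,K,m₁,M)`, Tao–Ziegler) is p2's `PadicRank2SketchG3` §E, whose
hypothesis `ClosedFormHeights p m n (p^{-ν})` follows from `closedFormHeights` here
(`‖n‖_p² ≤ ‖n‖_p ≤ p^{-ν}`) and whose `schneider_of_padicRegulatorOf_ne_zero` is the tree theorem
`schneiderConjecture_of_padicRegulatorOf_pair_ne_zero`.
-/

noncomputable section

open scoped Classical
open Literature.NumberTheory.EllipticCurves Literature.NumberTheory.EllipticCurves.Zywina2025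
open WeierstrassCurve

namespace Summit.BirchSwinnertonDyer.Rank2Observatory.ZywinaFamily

/-! ### The heights: `⟨P,P⟩ = ¼ ĥ_p(2P) = ½ log_p(num x(2P))^{1/2} + O(‖n‖_p²)` -/

section Heights

variable {p : ℕ} [Fact p.Prime]

/-- `‖log_p y‖ = ‖1 - y‖` for `‖1 - y‖ < 1`, `p` odd. -/
private theorem norm_padicLog_eq' (hp : p ≠ 2) {y : ℚ_[p]} (hy : ‖1 - y‖ < 1) :
    ‖padicLog p y‖ = ‖1 - y‖ := by
  have h2 : ‖(2 : ℚ_[p])‖ = 1 := by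
    rw [show (2 : ℚ_[p]) = ((2 : ℕ) : ℚ_[p]) by norm_cast, Padic.norm_natCast_eq_one_iff]
    exact (Nat.coprime_primes Fact.out Nat.prime_two).mpr hp
  rw [padicLog_eq_padicLogSeries hy]
  exact norm_padicLogSeries_eq (by rwa [h2])

/-- **From a double to the point.** If `2P = Q = (x, y)` is admissible for the canonical datum `D`
(`a₁ = a₃ = 0`, `ℤ`-integral, `p` odd), `‖x‖_p⁻¹ ≤ ε` and `‖log_p(num x) - 4Λ‖_p ≤ ε`, then
`‖⟨P, P⟩_D - Λ‖_p ≤ ε` (`⟨Q,Q⟩ = 4⟨P,P⟩`, `‖4‖_p = 1`, and LEMMA H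
`norm_canonicalPAdicHeight_sub_padicLog_num_le_inv`). -/
theorem norm_pairing_sub_le_of_two_nsmul {W : WeierstrassCurve ℚ} [W.IsIntegral ℤ]
    [W.IsCharNeTwoNF] (hp : p ≠ 2) {D : PAdicHeightData W p} (hD : D.IsCanonical)
    {P : W.toAffine.Point} {x y : ℚ} {h : W.toAffine.Nonsingular x y}
    (hQ : 2 • P = .some x y h) (hadm : W.IsAdmissible p (.some x y h)) {ε : ℝ}
    (hx : ‖(x : ℚ_[p])‖⁻¹ ≤ ε) {Λ : ℚ_[p]} (hnum : ‖padicLog p (x.num : ℚ_[p]) - 4 * Λ‖ ≤ ε) :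
    ‖D.pairing P P - Λ‖ ≤ ε := by
  have hH := hD.norm_pairing_self_sub_padicLog_num_le_inv _ _ hp hadm
  rw [← hQ] at hH
  have h4 : D.pairing (2 • P) (2 • P) = 4 * D.pairing P P := by
    rw [map_nsmul, map_nsmul, AddMonoidHom.nsmul_apply, smul_smul, nsmul_eq_mul]; norm_num
  rw [h4] at hH
  have hn4 : ‖(4 : ℚ_[p])‖ = 1 := by
    rw [show (4 : ℚ_[p]) = ((4 : ℕ) : ℚ_[p]) by norm_cast, Padic.norm_natCast_eq_one_iff,
      show (4 : ℕ) = 2 ^ 2 by norm_num]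
    exact Nat.Coprime.pow_right 2 ((Nat.coprime_primes Fact.out Nat.prime_two).mpr hp)
  have key : D.pairing P P - Λ = 4⁻¹ * ((4 * D.pairing P P - padicLog p (x.num : ℚ_[p])) +
      (padicLog p (x.num : ℚ_[p]) - 4 * Λ)) := by
    field_simp; ring
  rw [key, norm_mul, norm_inv, hn4, inv_one, one_mul]
  exact (IsUltrametricDist.norm_add_le_max _ _).trans (max_le (hH.trans hx) hnum)

/-- **The numerator term.** For natural numbers `α = m^k + n²·w` (`k = 1, 2`) with `p ∣ n`,
`p ∤ m`: `‖2 log_p α - 2k log_p m‖_p ≤ ‖n‖_p²` — here in the form needed: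
`α = m·c + n²·w` resp. handled through `u = α/m^k - 1`, `‖u‖ ≤ ‖n‖²`. -/
theorem norm_two_log_sub_le (hp : p ≠ 2) {α M u : ℚ_[p]} (hM : M ≠ 0) (hα : α = M * (1 + u))
    {ε : ℝ} (hu : ‖u‖ ≤ ε) (hε : ε < 1) :
    ‖2 * padicLog p α - 2 * padicLog p M‖ ≤ ε := by
  have hu1 : ‖1 - (1 + u)‖ < 1 := by
    rw [sub_add_cancel_left, norm_neg]; exact hu.trans_lt hε
  have h1u : 1 + u ≠ 0 := by
    intro h0; rw [h0, sub_zero, norm_one] at hu1; exact lt_irrefl _ hu1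
  rw [hα, padicLog_mul_holds p hM h1u, ← mul_sub, add_sub_cancel_left, norm_mul,
    norm_padicLog_eq' hp hu1, sub_add_cancel_left, norm_neg]
  calc ‖(2 : ℚ_[p])‖ * ‖u‖ ≤ 1 * ‖u‖ := by
        gcongr; simpa using norm_natCast_le_one (p := p) 2
    _ ≤ ε := by rw [one_mul]; exact hu

variable {m n : ℕ}

/-- `‖n‖_p < 1`, `‖m‖_p = 1`, casts, for `p ∣ n`, `p ≥ 5`. -/
private theorem norm_facts (h : ZywinaAdmissible m n) (hpn : p ∣ n) :
    ‖(n : ℚ_[p])‖ < 1 ∧ ‖(m : ℚ_[p])‖ = 1 ∧ (m : ℚ_[p]) ≠ 0 ∧ ‖(n : ℚ_[p])‖ ^ 2 < 1 := by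
  have hn : ‖(n : ℚ_[p])‖ < 1 := Padic.norm_natCast_lt_one_iff.mpr hpn
  have hm : ‖(m : ℚ_[p])‖ = 1 :=
    Padic.norm_natCast_eq_one_iff.mpr ((Nat.Prime.coprime_iff_not_dvd Fact.out).mpr (not_p_dvd_m h hpn))
  refine ⟨hn, hm, fun h0 => by rw [h0, norm_zero] at hm; exact zero_ne_one hm, ?_⟩
  exact pow_lt_one₀ (norm_nonneg _) hn two_ne_zero

/-- `‖w · n² / M‖_p ≤ ‖n‖_p²` for `w` integral and `‖M‖_p = 1`. -/
private theorem norm_u_le {w M : ℚ_[p]} (hw : ‖w‖ ≤ 1) (hM : ‖M‖ = 1) :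
    ‖w * (n : ℚ_[p]) ^ 2 / M‖ ≤ ‖(n : ℚ_[p])‖ ^ 2 := by
  rw [norm_div, hM, div_one, norm_mul, norm_pow]
  exact mul_le_of_le_one_left (pow_nonneg (norm_nonneg _) 2) hw

/-- **`⟨P₁, P₁⟩ = ½ log_p m + O(‖n‖_p²).`** -/
theorem norm_pairing_P₁_sub_le (h : ZywinaAdmissible m n) (hp : 5 ≤ p) (hpn : p ∣ n)
    {D : PAdicHeightData (zywinaCurve m n) p} (hD : D.IsCanonical) :
    ‖D.pairing (.some _ _ (nonsingular_P₁ h)) (.some _ _ (nonsingular_P₁ h)) -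
        padicLog p (m : ℚ_[p]) / 2‖ ≤ ‖(n : ℚ_[p])‖ ^ 2 := by
  haveI := isCharNeTwoNF_zywinaCurve m n
  haveI := isIntegral_zywinaCurve m n
  have hp2 : p ≠ 2 := by omega
  obtain ⟨hn1, hm1, hm0, hn2⟩ := norm_facts h hpn
  obtain ⟨y', h', e⟩ := two_nsmul_P₁ h
  obtain ⟨hadm, hx⟩ := isAdmissible_two_nsmul_P₁ h hp hpn h'
  refine norm_pairing_sub_le_of_two_nsmul hp2 hD e hadm hx.le ?_
  rw [num_sq_div_sq (coprime_α₁ h) (by have := (adm_n_pos h); omega)]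
  push_cast
  have hα0 : ((m : ℚ_[p]) + 28 * (n : ℚ_[p]) ^ 2) ≠ 0 := by
    have : ((m + 28 * n ^ 2 : ℕ) : ℚ_[p]) ≠ 0 := by
      intro h0
      have := Padic.norm_natCast_eq_one_iff.mpr (coprime_p_α h hpn).1
      rw [h0, norm_zero] at this; exact zero_ne_one this
    push_cast at this; exact this
  rw [padicLog_sq hα0, show 4 * (padicLog p (m : ℚ_[p]) / 2) = 2 * padicLog p (m : ℚ_[p]) by ring]
  refine norm_two_log_sub_le hp2 hm0 (u := 28 * (n : ℚ_[p]) ^ 2 / m) (by field_simp) ?_ hn2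
  exact norm_u_le (by simpa using norm_natCast_le_one (p := p) 28) hm1

/-- **`⟨P₂, P₂⟩ = log_p m + O(‖n‖_p²).`** -/
theorem norm_pairing_P₂_sub_le (h : ZywinaAdmissible m n) (hp : 5 ≤ p) (hpn : p ∣ n)
    {D : PAdicHeightData (zywinaCurve m n) p} (hD : D.IsCanonical) :
    ‖D.pairing (.some _ _ (nonsingular_P₂ h)) (.some _ _ (nonsingular_P₂ h)) -
        2 * (padicLog p (m : ℚ_[p]) / 2)‖ ≤ ‖(n : ℚ_[p])‖ ^ 2 := by
  haveI := isCharNeTwoNF_zywinaCurve m n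
  haveI := isIntegral_zywinaCurve m n
  have hp2 : p ≠ 2 := by omega
  obtain ⟨hn1, hm1, hm0, hn2⟩ := norm_facts h hpn
  obtain ⟨y', h', e⟩ := two_nsmul_P₂ h
  obtain ⟨hadm, hx⟩ := isAdmissible_two_nsmul_P₂ h hp hpn h'
  refine norm_pairing_sub_le_of_two_nsmul hp2 hD e hadm hx.le ?_
  rw [den₂_sq_eq, num_sq_div_sq (coprime_α₂ h) (by have := (adm_n_pos h); have := tAbs_pos h; positivity)]
  push_cast
  have hα0 : ((m : ℚ_[p]) ^ 2 + 41 * m * (n : ℚ_[p]) ^ 2 + 76 * (n : ℚ_[p]) ^ 4) ≠ 0 := by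
    have : ((m ^ 2 + 41 * m * n ^ 2 + 76 * n ^ 4 : ℕ) : ℚ_[p]) ≠ 0 := by
      intro h0
      have := Padic.norm_natCast_eq_one_iff.mpr (coprime_p_α h hpn).2.1
      rw [h0, norm_zero] at this; exact zero_ne_one this
    push_cast at this; exact this
  have hm2 : (m : ℚ_[p]) ^ 2 ≠ 0 := pow_ne_zero 2 hm0
  rw [padicLog_sq hα0, show 4 * (2 * (padicLog p (m : ℚ_[p]) / 2)) =
    2 * (2 * padicLog p (m : ℚ_[p])) by ring, ← padicLog_sq hm0]
  refine norm_two_log_sub_le hp2 hm2 (u := (41 * m + 76 * (n : ℚ_[p]) ^ 2) * (n : ℚ_[p]) ^ 2 / m ^ 2)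
    (by field_simp; ring) ?_ hn2
  refine norm_u_le ?_ (by rw [norm_pow, hm1, one_pow])
  refine (IsUltrametricDist.norm_add_le_max _ _).trans (max_le ?_ ?_)
  · rw [norm_mul, hm1, mul_one]; simpa using norm_natCast_le_one (p := p) 41
  · rw [norm_mul, norm_pow]
    exact mul_le_one₀ (by simpa using norm_natCast_le_one (p := p) 76) (pow_nonneg (norm_nonneg _) _)
      (pow_le_one₀ (norm_nonneg _) hn1.le)

/-- **`⟨P₁+P₂, P₁+P₂⟩ = ½ log_p m + O(‖n‖_p²).`** -/
theorem norm_pairing_P₁_add_P₂_sub_le (h : ZywinaAdmissible m n) (hp : 5 ≤ p) (hpn : p ∣ n)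
    {D : PAdicHeightData (zywinaCurve m n) p} (hD : D.IsCanonical) :
    ‖D.pairing (.some _ _ (nonsingular_P₁ h) + .some _ _ (nonsingular_P₂ h))
        (.some _ _ (nonsingular_P₁ h) + .some _ _ (nonsingular_P₂ h)) - padicLog p (m : ℚ_[p]) / 2‖ ≤
      ‖(n : ℚ_[p])‖ ^ 2 := by
  haveI := isCharNeTwoNF_zywinaCurve m n
  haveI := isIntegral_zywinaCurve m n
  have hp2 : p ≠ 2 := by omega
  obtain ⟨hn1, hm1, hm0, hn2⟩ := norm_facts h hpn
  obtain ⟨y₁, h₁, e₁⟩ := two_nsmul_P₁ h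
  obtain ⟨y₂, h₂, e₂⟩ := two_nsmul_P₂ h
  obtain ⟨y₃, h₃, e₃⟩ := two_nsmul_P₁_add_P₂ h
  obtain ⟨hadm, hx⟩ := isAdmissible_two_nsmul_P₁_add_P₂ h hp hpn e₁ e₂ e₃
  refine norm_pairing_sub_le_of_two_nsmul hp2 hD e₃ hadm hx.le ?_
  rw [num_sq_div_sq (coprime_α₃ h) (by have := (adm_n_pos h); omega)]
  push_cast
  have hα0 : ((m : ℚ_[p]) + 13 * (n : ℚ_[p]) ^ 2) ≠ 0 := by
    have : ((m + 13 * n ^ 2 : ℕ) : ℚ_[p]) ≠ 0 := by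
      intro h0
      have := Padic.norm_natCast_eq_one_iff.mpr (coprime_p_α h hpn).2.2
      rw [h0, norm_zero] at this; exact zero_ne_one this
    push_cast at this; exact this
  rw [padicLog_sq hα0, show 4 * (padicLog p (m : ℚ_[p]) / 2) = 2 * padicLog p (m : ℚ_[p]) by ring]
  refine norm_two_log_sub_le hp2 hm0 (u := 13 * (n : ℚ_[p]) ^ 2 / m) (by field_simp) ?_ hn2
  exact norm_u_le (by simpa using norm_natCast_le_one (p := p) 13) hm1

end Heights

/-! ### THEOREM R* (i): the closed form, and (ii): Schneider's conjecture for `E_{m,n}` at `p` -/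

section ClosedForm

variable {m n : ℕ} {p : ℕ} [Fact p.Prime]

/-- **THEOREM R\* (i) (cell bsd-rank2, p2-g3; strong form).** For `(m, n)` Zywina-admissible, a prime
`p ≥ 5` with `p ∣ n`, and `D` THE canonical `p`-adic height datum of `E_{m,n}` (`IsCanonical`), with
`Λ = ½ log_p m`:
`‖⟨P₁,P₁⟩ - Λ‖_p ≤ ‖n‖_p²`, `‖⟨P₂,P₂⟩ - 2Λ‖_p ≤ ‖n‖_p²`, `‖⟨P₁+P₂,P₁+P₂⟩ - Λ‖_p ≤ ‖n‖_p²`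
(`‖n‖_p² = p^{-2ν}`, `ν = v_p(n)`). -/
theorem closedFormHeights (h : ZywinaAdmissible m n) (hp : 5 ≤ p) (hpn : p ∣ n)
    {D : PAdicHeightData (zywinaCurve m n) p} (hD : D.IsCanonical) :
    ‖D.pairing (.some _ _ (nonsingular_P₁ h)) (.some _ _ (nonsingular_P₁ h)) -
        padicLog p (m : ℚ_[p]) / 2‖ ≤ ‖(n : ℚ_[p])‖ ^ 2 ∧
    ‖D.pairing (.some _ _ (nonsingular_P₂ h)) (.some _ _ (nonsingular_P₂ h)) -
        2 * (padicLog p (m : ℚ_[p]) / 2)‖ ≤ ‖(n : ℚ_[p])‖ ^ 2 ∧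
    ‖D.pairing (.some _ _ (nonsingular_P₁ h) + .some _ _ (nonsingular_P₂ h))
        (.some _ _ (nonsingular_P₁ h) + .some _ _ (nonsingular_P₂ h)) - padicLog p (m : ℚ_[p]) / 2‖ ≤
      ‖(n : ℚ_[p])‖ ^ 2 :=
  ⟨norm_pairing_P₁_sub_le h hp hpn hD, norm_pairing_P₂_sub_le h hp hpn hD,
    norm_pairing_P₁_add_P₂_sub_le h hp hpn hD⟩

/-- `‖n‖_p² ≤ p⁻²` under `p ∣ n` (so the radius is at most `p^{-2}`, in particular `< 1`). -/
theorem norm_n_sq_le (hpn : p ∣ n) : ‖(n : ℚ_[p])‖ ^ 2 ≤ ((p : ℝ) ^ 2)⁻¹ := by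
  have hp : (1 : ℝ) < p := by exact_mod_cast (Fact.out : p.Prime).one_lt
  obtain ⟨k, rfl⟩ := hpn
  push_cast
  rw [norm_mul, Padic.norm_p, mul_pow, inv_pow]
  exact mul_le_of_le_one_right (by positivity)
    (pow_le_one₀ (norm_nonneg _) (by simpa using norm_natCast_le_one (p := p) k))

/-! #### The `2 × 2` ultrametric perturbation (after p2-g3's `PadicRank2SketchG3` §A–§B) -/

/-- Ultrametric bookkeeping: `‖x‖, ‖y‖ ≤ ε ⇒ ‖x + y‖ ≤ ε`. -/
private theorem norm_add_le_of_le' {x y : ℚ_[p]} {ε : ℝ} (hx : ‖x‖ ≤ ε)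
    (hy : ‖y‖ ≤ ε) : ‖x + y‖ ≤ ε :=
  (IsUltrametricDist.norm_add_le_max x y).trans (max_le hx hy)

/-- In `ℚ_p` (`p` odd): if `a ≡ Λ`, `b ≡ 2Λ`, `h₃ = a + 2c + b ≡ Λ` up to `ε < ‖Λ‖`, then
`a b - c² ≠ 0` (indeed `≡ Λ²`). -/
private theorem det_ne_zero_of_near (hp : p ≠ 2) {a b c h₃ Λ : ℚ_[p]} {ε : ℝ} (hε : ε < ‖Λ‖)
    (hpar : h₃ = a + 2 * c + b) (ha : ‖a - Λ‖ ≤ ε) (hb : ‖b - 2 * Λ‖ ≤ ε) (h3 : ‖h₃ - Λ‖ ≤ ε) :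
    a * b - c * c ≠ 0 := by
  have h2 : ‖(2 : ℚ_[p])‖ = 1 := by
    rw [show (2 : ℚ_[p]) = ((2 : ℕ) : ℚ_[p]) by norm_cast, Padic.norm_natCast_eq_one_iff]
    exact (Nat.coprime_primes Fact.out Nat.prime_two).mpr hp
  have n2 : ∀ {x : ℚ_[p]} {δ : ℝ}, ‖x‖ ≤ δ → ‖2 * x‖ ≤ δ := fun hx => by
    rw [norm_mul, h2, one_mul]; exact hx
  -- the cross term
  have hc : ‖c + Λ‖ ≤ ε := by
    have key : c + Λ = 2⁻¹ * ((h₃ - Λ) + -(a - Λ) + -(b - 2 * Λ)) := by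
      rw [hpar]; field_simp; ring
    rw [key, norm_mul, norm_inv, h2, inv_one, one_mul]
    refine norm_add_le_of_le' (norm_add_le_of_le' h3 ?_) ?_ <;> rwa [norm_neg]
  have hε0 : 0 ≤ ε := (norm_nonneg _).trans ha
  have hΛ : 0 < ‖Λ‖ := hε0.trans_lt hε
  have key : a * b - c * c =
      Λ ^ 2 + (Λ * (2 * (a - Λ) + (b - 2 * Λ) + 2 * (c + Λ)) +
        ((a - Λ) * (b - 2 * Λ) - (c + Λ) * (c + Λ))) := by ring
  rw [key]
  have hlt : ‖Λ * (2 * (a - Λ) + (b - 2 * Λ) + 2 * (c + Λ)) +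
      ((a - Λ) * (b - 2 * Λ) - (c + Λ) * (c + Λ))‖ < ‖Λ‖ ^ 2 := by
    have hsq : ‖Λ‖ ^ 2 = ‖Λ‖ * ‖Λ‖ := sq _
    refine (IsUltrametricDist.norm_add_le_max _ _).trans_lt (max_lt ?_ ?_)
    · rw [norm_mul, hsq]
      exact mul_lt_mul' le_rfl ((norm_add_le_of_le' (norm_add_le_of_le' (n2 ha) hb)
        (n2 hc)).trans_lt hε) (norm_nonneg _) hΛ
    · rw [sub_eq_add_neg]
      refine (IsUltrametricDist.norm_add_le_max _ _).trans_lt (max_lt ?_ ?_)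
      · rw [norm_mul, hsq]
        exact mul_lt_mul'' (ha.trans_lt hε) (hb.trans_lt hε) (norm_nonneg _) (norm_nonneg _)
      · rw [norm_neg, norm_mul, hsq]
        exact mul_lt_mul'' (hc.trans_lt hε) (hc.trans_lt hε) (norm_nonneg _) (norm_nonneg _)
  -- `x₀ + e ≠ 0` when `‖e‖ < ‖x₀‖`
  intro h0
  have he : Λ * (2 * (a - Λ) + (b - 2 * Λ) + 2 * (c + Λ)) +
      ((a - Λ) * (b - 2 * Λ) - (c + Λ) * (c + Λ)) = -Λ ^ 2 := by linear_combination h0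
  rw [he, norm_neg, norm_pow] at hlt
  exact lt_irrefl _ hlt

/-- A generic `2 × 2` regulator: for points `P, Q` with `⟨P,P⟩ ≈ Λ`, `⟨Q,Q⟩ ≈ 2Λ`,
`⟨P+Q,P+Q⟩ ≈ Λ` up to `ε < ‖Λ‖_p` (`p` odd), `Reg_D(P, Q) ≠ 0`. -/
theorem padicRegulatorOf_pair_ne_zero_of_near {W : WeierstrassCurve ℚ} (hp : p ≠ 2)
    (D : PAdicHeightData W p) (P Q : W.toAffine.Point) {Λ : ℚ_[p]} {ε : ℝ} (hε : ε < ‖Λ‖)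
    (hP : ‖D.pairing P P - Λ‖ ≤ ε) (hQ : ‖D.pairing Q Q - 2 * Λ‖ ≤ ε)
    (hPQ : ‖D.pairing (P + Q) (P + Q) - Λ‖ ≤ ε) : padicRegulatorOf D ![P, Q] ≠ 0 := by
  have hreg : padicRegulatorOf D ![P, Q] =
      D.pairing P P * D.pairing Q Q - D.pairing P Q * D.pairing P Q := by
    unfold padicRegulatorOf PAdicHeightData.pairingMatrix
    have e := Matrix.det_fin_two (Matrix.of fun i j => D.pairing (![P, Q] i) (![P, Q] j))
    simp only [Matrix.of_apply, Matrix.cons_val_zero, Matrix.cons_val_one, D.symm Q P] at e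
    convert e using 3
  have hpar : D.pairing (P + Q) (P + Q) = D.pairing P P + 2 * D.pairing P Q + D.pairing Q Q := by
    simp only [map_add, AddMonoidHom.add_apply, D.symm Q P]; ring
  rw [hreg]
  exact det_ne_zero_of_near hp hε hpar hP hQ hPQ

/-- **THEOREM R\* (ii) (member level).** If moreover `‖n‖_p² < ‖½ log_p m‖_p` (`2ν > μ`,
`μ = v_p(m^{p-1} - 1)`), the `p`-adic regulator of `(P₁, P₂)` for the canonical datum is non-zero. -/
theorem padicRegulatorOf_ne_zero (h : ZywinaAdmissible m n) (hp : 5 ≤ p) (hpn : p ∣ n)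
    {D : PAdicHeightData (zywinaCurve m n) p} (hD : D.IsCanonical)
    (hdom : ‖(n : ℚ_[p])‖ ^ 2 < ‖padicLog p (m : ℚ_[p]) / 2‖) :
    padicRegulatorOf D ![.some _ _ (nonsingular_P₁ h), .some _ _ (nonsingular_P₂ h)] ≠ 0 := by
  obtain ⟨h₁, h₂, h₃⟩ := closedFormHeights h hp hpn hD
  exact padicRegulatorOf_pair_ne_zero_of_near (by omega) D _ _ hdom h₁ h₂ h₃

/-- **THEOREM R\* (iii) (member level): Schneider's conjecture for `E_{m,n}` at `p`.** For
`(m, n)` admissible, `p ≥ 5`, `p ∣ n`, `‖n‖_p² < ‖½ log_p m‖_p`, every canonical `p`-adic height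
datum of `E_{m,n}` is non-degenerate modulo torsion (`SchneiderConjecture D`): by (ii) and the index
lemma `schneiderConjecture_of_padicRegulatorOf_pair_ne_zero` on Zywina's rank-`2` curve
(`mordellWeilRank_zywinaCurve`). -/
theorem schneiderConjecture (h : ZywinaAdmissible m n) (hp : 5 ≤ p) (hpn : p ∣ n)
    {D : PAdicHeightData (zywinaCurve m n) p} (hD : D.IsCanonical)
    (hdom : ‖(n : ℚ_[p])‖ ^ 2 < ‖padicLog p (m : ℚ_[p]) / 2‖) : SchneiderConjecture D := by
  haveI := isElliptic_zywinaCurve h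
  exact schneiderConjecture_of_padicRegulatorOf_pair_ne_zero D _ _
    (mordellWeilRank_zywinaCurve h) (padicRegulatorOf_ne_zero h hp hpn hD hdom)

end ClosedForm
end Summit.BirchSwinnertonDyer.Rank2Observatory.ZywinaFamily
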